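import Mathlib
import Literature.Analysis.OperatorTheory.ContractiveDetComplexity
import HarnessLib

/-!
# Stub `stub_sameSize_normal` of line `birth` (crux `ContractivityPrice.PriceOfContractivity`,
item stmt-ValiantsHypothesis-10583)

**Partial case (normal `K₀`): no scaling gap.** If the Sylvester pencil
`det (1 + diag (X ∘ κ) · K₀)` has no zero on the closed polydisc of radius `2` and `K₀` is normal
(`K₀ᴴ K₀ = K₀ K₀ᴴ`), then the SAME pencil is already a norm-`1/2` realization: one may take
`K₁ := K₀`, `κ₁ := κ`.

Proof.
* Zero-freeness at the constant points `z ≡ t`, `‖t‖ ≤ 2`, says `det (1 + t • K₀) ≠ 0`; for an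
  eigenvalue `k` of `K₀` with `‖k‖ ≥ 1/2` the choice `t := -k⁻¹` gives
  `1 + t • K₀ = k⁻¹ • (k • 1 - K₀)`, whose determinant vanishes. Hence every point of the spectrum
  of `K₀` has modulus `< 1/2` (`norm_lt_half_of_mem_spectrum`).
* `Matrix.toEuclideanCLM` is a star-algebra equivalence onto the C⋆-algebra of bounded operators on
  `EuclideanSpace ℂ n`, so the image `T` of a normal matrix is star-normal with the same spectrum
  (`AlgEquiv.spectrum_eq`), and `‖T‖ = spectralRadius T` (`IsStarNormal.spectralRadius_eq_nnnorm`)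
  is the supremum of the moduli of the spectrum, `≤ 1/2`
  (`norm_toEuclideanCLM_le_of_conjTranspose_comm`).

No definitions; pure theorem file serving the lead's skeleton `work/PriceOfContractivity.lean`.
-/

-- D-0017: a single-problem summit is `Summits/<S>/<S>/…` with namespace `Summit.<S>.<S>.…` by design.
set_option linter.dupNamespace false

namespace Summit.ValiantsHypothesis.ValiantsHypothesis.Theorems.PriceOfContractivity.Normal

open scoped NNReal ENNReal

/-- **Operator norm of a normal matrix from its spectrum.** If `Kᴴ K = K Kᴴ` and every point of
the spectrum of `K` has modulus `≤ r` (`0 ≤ r`), then `‖K‖_op ≤ r`: the bounded operator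
`Matrix.toEuclideanCLM K` is star-normal with the same spectrum, and in a C⋆-algebra the norm of a
normal element is its spectral radius. [folklore] -/
theorem norm_toEuclideanCLM_le_of_conjTranspose_comm {n : Type*} [Fintype n] [DecidableEq n]
    (K : Matrix n n ℂ) (hN : K.conjTranspose * K = K * K.conjTranspose) {r : ℝ} (hr₀ : 0 ≤ r)
    (hr : ∀ k ∈ spectrum ℂ K, ‖k‖ ≤ r) :
    ‖Matrix.toEuclideanCLM (n := n) (𝕜 := ℂ) K‖ ≤ r := by
  lift r to ℝ≥0 using hr₀
  have hT : IsStarNormal (Matrix.toEuclideanCLM (n := n) (𝕜 := ℂ) K) := by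
    refine ⟨?_⟩
    change star (Matrix.toEuclideanCLM (n := n) (𝕜 := ℂ) K) * Matrix.toEuclideanCLM (n := n) (𝕜 := ℂ) K
      = Matrix.toEuclideanCLM (n := n) (𝕜 := ℂ) K * star (Matrix.toEuclideanCLM (n := n) (𝕜 := ℂ) K)
    rw [← map_star, ← map_mul, ← map_mul, Matrix.star_eq_conjTranspose, hN]
  have hrad : spectralRadius ℂ (Matrix.toEuclideanCLM (n := n) (𝕜 := ℂ) K) ≤ (r : ℝ≥0∞) := by
    refine iSup₂_le fun k hk => ?_
    rw [AlgEquiv.spectrum_eq] at hk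
    exact_mod_cast hr k hk
  rw [IsStarNormal.spectralRadius_eq_nnnorm] at hrad
  have h : ‖Matrix.toEuclideanCLM (n := n) (𝕜 := ℂ) K‖₊ ≤ r := ENNReal.coe_le_coe.mp hrad
  exact h

/-- **Margin-2 zero-freeness confines the spectrum to the open disc of radius `1/2`.** If
`det (1 + diag (z ∘ κ) · K₀) ≠ 0` whenever all `‖z j‖ ≤ 2`, then every `k` in the spectrum of `K₀`
has `‖k‖ < 1/2`: otherwise `t := -k⁻¹` has `‖t‖ ≤ 2` and at the constant point `z ≡ t` the pencil
is `1 + t • K₀ = k⁻¹ • (k • 1 - K₀)`, which is singular. [folklore] -/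
theorem norm_lt_half_of_mem_spectrum {n : Type*} [Fintype n] [DecidableEq n] {σ : Type*}
    (K₀ : Matrix n n ℂ) (κ : n → σ)
    (hz : ∀ z : σ → ℂ, (∀ j, ‖z j‖ ≤ 2) →
      MvPolynomial.eval z (1 + Matrix.diagonal (fun i => MvPolynomial.X (κ i)) *
        K₀.map (fun a : ℂ => (MvPolynomial.C a : MvPolynomial σ ℂ))).det ≠ 0)
    {k : ℂ} (hk : k ∈ spectrum ℂ K₀) : ‖k‖ < 1 / 2 := by
  refine not_le.mp fun h => ?_
  have hk0 : k ≠ 0 := by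
    rintro rfl
    norm_num at h
  have ht : ‖(-k⁻¹ : ℂ)‖ ≤ 2 := by
    rw [norm_neg, norm_inv]
    exact inv_le_of_inv_le₀ two_pos (by rwa [one_div] at h)
  have hdet : (algebraMap ℂ (Matrix n n ℂ) k - K₀).det = 0 := by
    have := spectrum.mem_iff.mp hk
    rwa [Matrix.isUnit_iff_isUnit_det, isUnit_iff_ne_zero, not_not] at this
  have key : (1 : Matrix n n ℂ) + Matrix.diagonal (fun _ => (-k⁻¹ : ℂ)) * K₀
      = k⁻¹ • (algebraMap ℂ (Matrix n n ℂ) k - K₀) := by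
    rw [← Matrix.smul_eq_diagonal_mul, Algebra.algebraMap_eq_smul_one, smul_sub, smul_smul,
      inv_mul_cancel₀ hk0, one_smul, neg_smul, sub_eq_add_neg]
  have h₁ := hz (fun _ => -k⁻¹) (fun _ => ht)
  rw [Literature.Analysis.OperatorTheory.eval_det_one_add_diagonal_mul_map_C] at h₁
  apply h₁
  show ((1 : Matrix n n ℂ) + Matrix.diagonal (fun _ => (-k⁻¹ : ℂ)) * K₀).det = 0
  rw [key, Matrix.det_smul, hdet, mul_zero]

/-- **Partial case (normal `K₀`) of the price of contractivity, same size.** A Sylvester pencil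
`det (1 + diag (X ∘ κ) · K₀)` with `K₀` normal and no zero on the closed polydisc of radius `2`
is re-realized at the same size with operator norm `≤ 1/2` — by itself: `K₁ := K₀`, `κ₁ := κ`,
since `‖K₀‖_op = ρ(K₀) < 1/2`. [folklore] -/
theorem stub_sameSize_normal :
    ∀ (R : ℕ) {σ : Type} (K₀ : Matrix (Fin R) (Fin R) ℂ) (κ : Fin R → σ),
      K₀.conjTranspose * K₀ = K₀ * K₀.conjTranspose →
      (∀ z : σ → ℂ, (∀ j, ‖z j‖ ≤ 2) → MvPolynomial.eval z (1 + Matrix.diagonal (fun i => MvPolynomial.X (κ i)) * K₀.map (fun a : ℂ => (MvPolynomial.C a : MvPolynomial σ ℂ))).det ≠ 0) →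
      ∃ (K₁ : Matrix (Fin R) (Fin R) ℂ) (κ₁ : Fin R → σ),
        ‖Matrix.toEuclideanCLM (𝕜 := ℂ) K₁‖ ≤ 1 / 2 ∧
        (1 + Matrix.diagonal (fun i => MvPolynomial.X (κ i)) * K₀.map (fun a : ℂ => (MvPolynomial.C a : MvPolynomial σ ℂ))).det =
          (1 + Matrix.diagonal (fun i => MvPolynomial.X (κ₁ i)) * K₁.map (fun a : ℂ => (MvPolynomial.C a : MvPolynomial σ ℂ))).det := by
  intro R σ K₀ κ hN hz
  refine ⟨K₀, κ, ?_, rfl⟩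
  exact norm_toEuclideanCLM_le_of_conjTranspose_comm K₀ hN (by norm_num)
    fun k hk => (norm_lt_half_of_mem_spectrum K₀ κ hz hk).le

end Summit.ValiantsHypothesis.ValiantsHypothesis.Theorems.PriceOfContractivity.Normal
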